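import Summits.CriticalPhenomena.CardyFormulaZ2.Theorems.CardyFlipRussoVoronoiHubFromSmirnovDelaunayPivot

/-!
# Stub `pencil_tie_or_localMax` of line `moebius-exact-delaunay-dilation-ward`
# (crux `VoronoiHubFromSmirnov`, stmt-CriticalPhenomena-6433)

PENCIL ANALYSIS OF A DEFECT DELAUNAY PAIR (planar part of I. Benjamini, O. Schramm, *Conformal
invariance of Voronoi percolation*, Comm. Math. Phys. 197 (1998), Lemma 4.2).  Fix `p ≠ q` in `ℂ`
and the pencil of centres `c t = p + (1/2 + t i)(q − p)`, `t : ℝ`, of the circles through `p` and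
`q`.  Let `F` be a finite set of competitor sites containing neither `p` nor `q`, and for `d ∈ F`
let `f_d t = dist(d, c t) − dist(p, c t)` be the clearance of `d` at parameter `t`.  Suppose that
on the parameter interval `[t₁, t₂]` every disc of the pencil is empty (`f_d ≥ 0` for all
`d ∈ F`), that the interval is touched at its two ends by two distinct sites `z₁, z₂ ∈ F`
(`f_{z₁} t₁ = 0 = f_{z₂} t₂`), and that no parameter has clearance `≥ τ` (for every `t` some
`f_d t < τ`).  Then EITHER some parameter `t ∈ [t₁, t₂]` carries a TIE — two distinct sites
`a ≠ b` of `F` at the same distance from `c t`, this distance being minimal over `F` and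
`< dist(p, c t) + τ` (the generic navel, `k = 2`) — OR
some single site `d ∈ F` has a LOCAL MAXIMUM of its clearance `f_d` at an interior parameter
`t ∈ (t₁, t₂)` with `f_d t < τ` (the stationary case `k = 1`, handled by the neighbouring stub
`pencil_localMax_dist_eq`).

Proof.  The minimal clearance `κ t = min_{d ∈ F} f_d t` is continuous, nonnegative on `[t₁, t₂]`,
vanishes at `t₁` and `t₂`, and is `< τ` throughout.  If `t₁ = t₂` the two touching sites tie.
Otherwise `κ` attains its maximum on the compact interval at some `t*`
(`IsCompact.exists_isMaxOn`).  If `κ t* = 0` then `κ ≡ 0`, so every parameter of the infinite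
interval is touched by one of the finitely many sites, hence (pigeonhole,
`Set.Infinite.exists_ne_map_eq_of_mapsTo`) one site `d` touches at two distinct parameters; by the
pencil identity `dist(d, c t)² − dist(p, c t)² = A(d) − 2 t σ(d)` (`dp_key`) this forces
`σ(d) = A(d) = 0`, i.e. `d ∈ {p, q}` (`pt_deg`), a contradiction.  If `κ t* > 0` then `t*` is
interior; a site `a` realising the minimum either ties with another site (first alternative) or is
the strict unique minimiser at `t*`, in which case `κ = f_a` near `t*` (finitely many strict
inequalities persist, `ContinuousAt.eventually_lt`, `Filter.eventually_all_finset`) and `t*` is a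
local maximum of `f_a` (second alternative).  The finite-family part is isolated in `pt_family`, the
pencil geometry in `pt_geom`.

No new definitions.
-/

noncomputable section

namespace Summit.CriticalPhenomena.CardyFormulaZ2.Cruxes.VoronoiHubFromSmirnov.MoebiusExactDelaunayDilationWard

/-- **Tie-or-Fermat dichotomy for a finite family of continuous functions.**  Let `f d`, `d ∈ F`,
be continuous real functions, nonnegative on `[t₁, t₂]` (`t₁ < t₂`), with `f z₁ t₁ = 0 = f z₂ t₂`
for some `z₁, z₂ ∈ F`, such that at every parameter of the interval some `f d` is `< τ`, and such
that no single `f d` vanishes at two distinct parameters of the interval.  Then either two distinct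
members tie at the minimum somewhere on `[t₁, t₂]` (with common value `< τ`), or some member has an
interior local maximum with value `< τ`. [folklore] -/
theorem pt_family {ι : Type*} {F : Finset ι} {f : ι → ℝ → ℝ} {t₁ t₂ τ : ℝ} {z₁ z₂ : ι}
    (hcont : ∀ d ∈ F, Continuous (f d)) (ht : t₁ < t₂) (hz₁ : z₁ ∈ F) (hz₂ : z₂ ∈ F)
    (hz₁eq : f z₁ t₁ = 0) (hz₂eq : f z₂ t₂ = 0)
    (hnonneg : ∀ d ∈ F, ∀ s ∈ Set.Icc t₁ t₂, 0 ≤ f d s)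
    (hclear : ∀ s ∈ Set.Icc t₁ t₂, ∃ d ∈ F, f d s < τ)
    (hsingle : ∀ d ∈ F, ∀ s ∈ Set.Icc t₁ t₂, ∀ s' ∈ Set.Icc t₁ t₂,
      f d s = 0 → f d s' = 0 → s = s') :
    (∃ t ∈ Set.Icc t₁ t₂, ∃ a ∈ F, ∃ b ∈ F,
        a ≠ b ∧ f a t = f b t ∧ f a t < τ ∧ ∀ d ∈ F, f a t ≤ f d t) ∨
      (∃ t ∈ Set.Ioo t₁ t₂, ∃ a ∈ F, IsLocalMax (f a) t ∧ f a t < τ) := by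
  classical
  have hF : F.Nonempty := ⟨z₁, hz₁⟩
  -- the minimal clearance `κ s = min_{d ∈ F} f d s` and its basic properties
  obtain ⟨κ, hκ_def⟩ : ∃ κ : ℝ → ℝ, ∀ s, κ s = F.inf' hF fun d => f d s := ⟨_, fun s => rfl⟩
  have hκ_le : ∀ d ∈ F, ∀ s, κ s ≤ f d s := fun d hd s =>
    (hκ_def s).trans_le (Finset.inf'_le (fun d => f d s) hd)
  have hκ_mem : ∀ s, ∃ d ∈ F, κ s = f d s := fun s => by
    obtain ⟨d, hd, h⟩ := Finset.exists_mem_eq_inf' hF fun d => f d s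
    exact ⟨d, hd, (hκ_def s).trans h⟩
  have hκ_ge : ∀ (s x : ℝ), (∀ d ∈ F, x ≤ f d s) → x ≤ κ s := fun s x h =>
    (Finset.le_inf' hF (fun d => f d s) h).trans_eq (hκ_def s).symm
  have hκ_nonneg : ∀ s ∈ Set.Icc t₁ t₂, 0 ≤ κ s := fun s hs =>
    hκ_ge s 0 fun d hd => hnonneg d hd s hs
  have hκ_lt : ∀ s ∈ Set.Icc t₁ t₂, κ s < τ := fun s hs => by
    obtain ⟨d, hd, hlt⟩ := hclear s hs
    exact (hκ_le d hd s).trans_lt hlt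
  have hκ₁ : κ t₁ = 0 :=
    le_antisymm ((hκ_le z₁ hz₁ t₁).trans_eq hz₁eq) (hκ_nonneg t₁ (Set.left_mem_Icc.2 ht.le))
  have hκ₂ : κ t₂ = 0 :=
    le_antisymm ((hκ_le z₂ hz₂ t₂).trans_eq hz₂eq) (hκ_nonneg t₂ (Set.right_mem_Icc.2 ht.le))
  have hκ_cont : Continuous κ := by
    have h : Continuous fun s => F.inf' hF fun d => f d s :=
      Continuous.finset_inf'_apply hF fun d hd => hcont d hd
    exact (funext hκ_def : κ = fun s => F.inf' hF fun d => f d s) ▸ h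
  -- a point of maximal minimal clearance on the compact interval
  obtain ⟨t, ht_mem, ht_max⟩ :=
    isCompact_Icc.exists_isMaxOn (Set.nonempty_Icc.2 ht.le) hκ_cont.continuousOn
  rcases (hκ_nonneg t ht_mem).eq_or_lt with hzero | hpos
  · -- `κ ≡ 0` on the interval: one member vanishes at two parameters (pigeonhole), impossible
    exfalso
    have hκ0 : ∀ s ∈ Set.Icc t₁ t₂, κ s = 0 := fun s hs =>
      le_antisymm ((ht_max hs).trans_eq hzero.symm) (hκ_nonneg s hs)
    choose g hg using hκ_mem
    obtain ⟨s, hs, s', hs', hne, heq⟩ :=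
      (Set.Icc_infinite ht).exists_ne_map_eq_of_mapsTo (f := g) (fun x _ => (hg x).1)
        F.finite_toSet
    have h1 : f (g s) s = 0 := ((hg s).2).symm.trans (hκ0 s hs)
    have h2 : f (g s) s' = 0 := by
      rw [heq]
      exact ((hg s').2).symm.trans (hκ0 s' hs')
    exact hne (hsingle (g s) (hg s).1 s hs s' hs' h1 h2)
  · -- positive maximum: `t` is interior
    have ht₁ : t₁ < t := lt_of_le_of_ne ht_mem.1 fun h => by
      rw [← h, hκ₁] at hpos
      exact lt_irrefl _ hpos
    have ht₂ : t < t₂ := lt_of_le_of_ne ht_mem.2 fun h => by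
      rw [h, hκ₂] at hpos
      exact lt_irrefl _ hpos
    obtain ⟨a, ha, hκa⟩ := hκ_mem t
    have haτ : f a t < τ := hκa ▸ hκ_lt t ht_mem
    by_cases htie : ∃ b ∈ F, b ≠ a ∧ f b t = f a t
    · -- a tie at the minimum
      obtain ⟨b, hb, hba, hfba⟩ := htie
      exact Or.inl ⟨t, ht_mem, a, ha, b, hb, hba.symm, hfba.symm, haτ,
        fun d hd => hκa ▸ hκ_le d hd t⟩
    · -- `a` is the strict unique minimiser at `t`: `κ = f a` near `t`, a local maximum of `f a`
      push Not at htie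
      refine Or.inr ⟨t, ⟨ht₁, ht₂⟩, a, ha, ?_, haτ⟩
      have hlt : ∀ b ∈ F, b ≠ a → f a t < f b t := fun b hb hba =>
        lt_of_le_of_ne (hκa ▸ hκ_le b hb t) (htie b hb hba).symm
      have hev : ∀ᶠ s in nhds t, ∀ b ∈ F, b ≠ a → f a s < f b s := by
        refine (Filter.eventually_all_finset F).2 fun b hb => ?_
        by_cases hba : b = a
        · exact Filter.Eventually.of_forall fun s h => absurd hba h
        · exact ((hcont a ha).continuousAt.eventually_lt (hcont b hb).continuousAt
            (hlt b hb hba)).mono fun s hs _ => hs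
      show ∀ᶠ s in nhds t, f a s ≤ f a t
      filter_upwards [hev, Icc_mem_nhds ht₁ ht₂] with s hs hsI
      calc f a s ≤ κ s := hκ_ge s (f a s) fun b hb => by
              by_cases hba : b = a
              · rw [hba]
              · exact (hs b hb hba).le
        _ ≤ κ t := ht_max hsI
        _ = f a t := hκa

/-- **Degenerate sites of the pencil.**  If both coefficients of the pencil identity vanish,
`|d − p|² − Re (conj (q − p)(d − p)) = 0` and `Im (conj (q − p)(d − p)) = 0`, then `d = p` or
`d = q` (the only points lying on every circle through `p` and `q`). [folklore] -/
theorem pt_deg {p q d : ℂ} (hpq : p ≠ q)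
    (hA : Complex.normSq (d - p) - (starRingEnd ℂ (q - p) * (d - p)).re = 0)
    (hσ : (starRingEnd ℂ (q - p) * (d - p)).im = 0) : d = p ∨ d = q := by
  have hv : q - p ≠ 0 := sub_ne_zero.2 hpq.symm
  have hcv : starRingEnd ℂ (q - p) ≠ 0 := (map_ne_zero _).2 hv
  set w : ℂ := starRingEnd ℂ (q - p) * (d - p) with hw
  have hAre : Complex.normSq (d - p) = w.re := sub_eq_zero.1 hA
  have hnorm : Complex.normSq w = Complex.normSq (q - p) * Complex.normSq (d - p) := by
    rw [hw, map_mul, Complex.normSq_conj]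
  have hre : w.re * (w.re - Complex.normSq (q - p)) = 0 := by
    have h := Complex.normSq_apply w
    rw [hσ, mul_zero, add_zero, hnorm, hAre] at h
    linear_combination -h
  rcases mul_eq_zero.1 hre with h0 | h1
  · left
    rw [h0] at hAre
    exact sub_eq_zero.1 (Complex.normSq_eq_zero.1 hAre)
  · right
    have hwre : w = (Complex.normSq (q - p) : ℂ) := by
      apply Complex.ext
      · rw [Complex.ofReal_re]
        exact sub_eq_zero.1 h1
      · rw [Complex.ofReal_im]
        exact hσ
    rw [Complex.normSq_eq_conj_mul_self, hw] at hwre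
    exact sub_left_inj.1 (mul_left_cancel₀ hcv hwre)

/-- The centre `p + (1/2 + t i)(q − p)` of the pencil, written with `Complex.I`, agrees with the
anonymous-constructor form `p + ⟨1/2, t⟩ (q − p)` used in `dp_key`. [folklore] -/
theorem pt_center_eq (p q : ℂ) (t : ℝ) :
    p + ((1/2 : ℂ) + (t : ℂ) * Complex.I) * (q - p) = p + (⟨1 / 2, t⟩ : ℂ) * (q - p) := by
  have h : ((1/2 : ℂ) + (t : ℂ) * Complex.I) = (⟨1 / 2, t⟩ : ℂ) :=
    Complex.ext (by simp) (by simp)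
  rw [h]

/-- **The pencil identity** for the centre `c t = p + (1/2 + t i)(q − p)`:
`dist(d, c t)² − dist(p, c t)² = (|d − p|² − Re (conj (q − p)(d − p))) − 2 t · σ(d)`,
`σ(d) = Im (conj (q − p)(d − p))` (`dp_key` transported along `pt_center_eq`). [folklore] -/
theorem pt_key (p q d : ℂ) (t : ℝ) :
    dist d (p + ((1/2 : ℂ) + (t : ℂ) * Complex.I) * (q - p)) ^ 2 -
        dist p (p + ((1/2 : ℂ) + (t : ℂ) * Complex.I) * (q - p)) ^ 2 =
      Complex.normSq (d - p) - (starRingEnd ℂ (q - p) * (d - p)).re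
        - 2 * t * (starRingEnd ℂ (q - p) * (d - p)).im := by
  rw [pt_center_eq]
  exact dp_key p q d t

/-- **Tie-or-Fermat dichotomy along a pencil (abstract centres).**  Let `c : ℝ → ℂ` be a
continuous family of centres whose powers satisfy the pencil identity
`dist(d, c t)² − dist(p, c t)² = A(d) − 2 t σ(d)` with `A(d) = σ(d) = 0` only for `d ∈ {p, q}`.
For a finite set `F ∌ p, q` of sites, an interval `[t₁, t₂]` of empty discs touched at its ends by
distinct sites `z₁, z₂ ∈ F` and carrying no clearance `≥ τ`, either some parameter carries a tie of
two distinct sites at the minimal distance (`< dist(p, c t) + τ`), or some site has an interior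
local maximum of its clearance `dist(d, c ·) − dist(p, c ·)`, of value `< τ`. [folklore] -/
theorem pt_geom {p q : ℂ} {F : Finset ℂ} {t₁ t₂ τ : ℝ} {z₁ z₂ : ℂ} {c : ℝ → ℂ} {σ A : ℂ → ℝ}
    (hc : Continuous c)
    (hkey : ∀ (d : ℂ) (t : ℝ), dist d (c t) ^ 2 - dist p (c t) ^ 2 = A d - 2 * t * σ d)
    (hdeg : ∀ d, A d = 0 → σ d = 0 → d = p ∨ d = q)
    (ht : t₁ ≤ t₂) (hτ : 0 < τ) (hpF : p ∉ F) (hqF : q ∉ F) (hz₁ : z₁ ∈ F) (hz₂ : z₂ ∈ F)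
    (hz : z₁ ≠ z₂) (hz₁eq : dist z₁ (c t₁) = dist p (c t₁))
    (hz₂eq : dist z₂ (c t₂) = dist p (c t₂))
    (hempty : ∀ d ∈ F, ∀ t ∈ Set.Icc t₁ t₂, dist p (c t) ≤ dist d (c t))
    (hclear : ∀ t ∈ Set.Icc t₁ t₂, ∃ d ∈ F, dist d (c t) < dist p (c t) + τ) :
    (∃ t ∈ Set.Icc t₁ t₂, ∃ a ∈ F, ∃ b ∈ F, a ≠ b ∧ dist a (c t) = dist b (c t) ∧
        dist a (c t) < dist p (c t) + τ ∧ ∀ d ∈ F, dist a (c t) ≤ dist d (c t)) ∨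
      (∃ t ∈ Set.Ioo t₁ t₂, ∃ d ∈ F,
        IsLocalMax (fun s => dist d (c s) - dist p (c s)) t ∧
          dist d (c t) < dist p (c t) + τ) := by
  rcases ht.eq_or_lt with rfl | hlt
  · -- degenerate interval: the two touching sites tie
    refine Or.inl ⟨t₁, Set.left_mem_Icc.2 le_rfl, z₁, hz₁, z₂, hz₂, hz, hz₁eq.trans hz₂eq.symm,
      ?_, fun d hd => ?_⟩
    · rw [hz₁eq]
      linarith
    · rw [hz₁eq]
      exact hempty d hd t₁ (Set.left_mem_Icc.2 le_rfl)
  · -- no site touches at two distinct parameters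
    have hsingle : ∀ d ∈ F, ∀ s ∈ Set.Icc t₁ t₂, ∀ s' ∈ Set.Icc t₁ t₂,
        dist d (c s) - dist p (c s) = 0 → dist d (c s') - dist p (c s') = 0 → s = s' := by
      intro d hd s _ s' _ h1 h2
      by_contra hne
      have h1' : dist d (c s) = dist p (c s) := sub_eq_zero.1 h1
      have h2' : dist d (c s') = dist p (c s') := sub_eq_zero.1 h2
      have e1 : A d - 2 * s * σ d = 0 := by rw [← hkey d s, h1', sub_self]
      have e2 : A d - 2 * s' * σ d = 0 := by rw [← hkey d s', h2', sub_self]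
      have hσ : σ d = 0 := by
        have h : (s - s') * σ d = 0 := by linear_combination (e2 - e1) / 2
        exact (mul_eq_zero.1 h).resolve_left (sub_ne_zero.2 hne)
      have hA : A d = 0 := by linear_combination e1 + 2 * s * hσ
      rcases hdeg d hA hσ with rfl | rfl
      · exact hpF hd
      · exact hqF hd
    have hmain := pt_family (F := F) (f := fun d s => dist d (c s) - dist p (c s)) (τ := τ)
      (fun d _ => (continuous_const.dist hc).sub (continuous_const.dist hc)) hlt hz₁ hz₂
      (sub_eq_zero.2 hz₁eq) (sub_eq_zero.2 hz₂eq)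
      (fun d hd s hs => sub_nonneg.2 (hempty d hd s hs))
      (fun s hs => by
        obtain ⟨d, hd, h⟩ := hclear s hs
        exact ⟨d, hd, by linarith⟩)
      hsingle
    rcases hmain with ⟨t, htI, a, ha, b, hb, hab, hfab, haτ, hmin⟩ | ⟨t, htI, a, ha, hloc, haτ⟩
    · refine Or.inl ⟨t, htI, a, ha, b, hb, hab, sub_left_inj.1 hfab, by linarith, fun d hd => ?_⟩
      have h := hmin d hd
      linarith
    · exact Or.inr ⟨t, htI, a, ha, hloc, by linarith⟩

/-- **Pencil analysis of a defect Delaunay pair** (stub `pencil_tie_or_localMax` of the line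
`moebius-exact-delaunay-dilation-ward`; planar part of Benjamini–Schramm 1998, Lemma 4.2).  Along
the pencil `c t = p + (1/2 + t i)(q − p)` of circles through `p ≠ q`, for a finite competitor set
`F ∌ p, q`, an interval `[t₁, t₂]` of empty discs touched at its two ends by distinct sites
`z₁, z₂ ∈ F` and carrying no clearance `≥ τ`: either some parameter `t ∈ [t₁, t₂]` carries a tie
of two distinct sites of `F` at the minimal distance from `c t`, this distance being
`< dist(p, c t) + τ`, or some site `d ∈ F` has a local maximum of its clearance
`dist(d, c ·) − dist(p, c ·)` at an interior parameter `t ∈ (t₁, t₂)`, of value `< τ`. [folklore] -/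
theorem pencil_tie_or_localMax : ∀ (p q : ℂ) (F : Finset ℂ) (t₁ t₂ τ : ℝ) (z₁ z₂ : ℂ), p ≠ q → t₁ ≤ t₂ → 0 < τ → p ∉ F → q ∉ F → z₁ ∈ F → z₂ ∈ F → z₁ ≠ z₂ → dist z₁ (p + ((1/2 : ℂ) + (t₁ : ℂ) * Complex.I) * (q - p)) = dist p (p + ((1/2 : ℂ) + (t₁ : ℂ) * Complex.I) * (q - p)) → dist z₂ (p + ((1/2 : ℂ) + (t₂ : ℂ) * Complex.I) * (q - p)) = dist p (p + ((1/2 : ℂ) + (t₂ : ℂ) * Complex.I) * (q - p)) → (∀ d ∈ F, ∀ t ∈ Set.Icc t₁ t₂, dist p (p + ((1/2 : ℂ) + (t : ℂ) * Complex.I) * (q - p)) ≤ dist d (p + ((1/2 : ℂ) + (t : ℂ) * Complex.I) * (q - p))) → (∀ t ∈ Set.Icc t₁ t₂, ∃ d ∈ F, dist d (p + ((1/2 : ℂ) + (t : ℂ) * Complex.I) * (q - p)) < dist p (p + ((1/2 : ℂ) + (t : ℂ) * Complex.I) * (q - p)) + τ) → (∃ t ∈ Set.Icc t₁ t₂, ∃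 a ∈ F, ∃ b ∈ F, a ≠ b ∧ dist a (p + ((1/2 : ℂ) + (t : ℂ) * Complex.I) * (q - p)) = dist b (p + ((1/2 : ℂ) + (t : ℂ) * Complex.I) * (q - p)) ∧ dist a (p + ((1/2 : ℂ) + (t : ℂ) * Complex.I) * (q - p)) < dist p (p + ((1/2 : ℂ) + (t : ℂ) * Complex.I) * (q - p)) + τ ∧ ∀ d ∈ F, dist a (p + ((1/2 : ℂ) + (t : ℂ) * Complex.I) * (q - p)) ≤ dist d (p + ((1/2 : ℂ) + (t : ℂ) * Complex.I) * (q - p))) ∨ (∃ t ∈ Set.Ioo t₁ t₂, ∃ d ∈ F, IsLocalMax (fun s : ℝ => dist d (p + ((1/2 : ℂ) + (s : ℂ) * Complex.I) * (q - p)) - dist p (p + ((1/2 : ℂ) + (s : ℂ) * Complex.I) * (q - p))) t ∧ dist d (p + ((1/2 : ℂ) + (t : ℂ) * Complex.I) * (q - p)) < dist p (p + ((1/2 : ℂ) + (t : ℂ) * Complex.I) * (q - p)) + τ) := by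
  intro p q F t₁ t₂ τ z₁ z₂ hpq ht hτ hpF hqF hz₁ hz₂ hz hz₁eq hz₂eq hempty hclear
  exact pt_geom (c := fun t : ℝ => p + ((1/2 : ℂ) + (t : ℂ) * Complex.I) * (q - p))
    (σ := fun d => (starRingEnd ℂ (q - p) * (d - p)).im)
    (A := fun d => Complex.normSq (d - p) - (starRingEnd ℂ (q - p) * (d - p)).re)
    (by fun_prop) (fun d t => pt_key p q d t) (fun d hA hσ => pt_deg hpq hA hσ)
    ht hτ hpF hqF hz₁ hz₂ hz hz₁eq hz₂eq hempty hclear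

end Summit.CriticalPhenomena.CardyFormulaZ2.Cruxes.VoronoiHubFromSmirnov.MoebiusExactDelaunayDilationWard

end
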